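import Literature.AnabelianGeometry.SemiGraphs.TemperedReconstructionCompat
import Literature.AnabelianGeometry.SemiGraphs.TemperedReconstructionAssemblyThm37
import HarnessLib

/-!
# Corollary 3.9 over the compatible reading: reduction to its steps (proof-only)

Mochizuki, *Semi-graphs of anabelioids*, Publ. RIMS **42** (2006), §3, Cor. 3.9, proof pp. 42–43
[cite: MochizukiSemiAnbd2006, Cor 3.9 pp.42-43].  The twin `Cor39Compat` (ruling χ2) from the steps
of the printed proof, exactly as `corollary_3_9_of_steps` / `corollary_3_9_of_thm37_i_iii` for the
literal `Cor39`, with R2 replaced by its twin R2′ `QuasiGeometricGraphDataCompat`: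
`cor39Compat_of_steps` and, binding everything the tree has proved, `cor39Compat_of_thm37_i_iii :
VerticialInjective → CompactInVerticial → QuasiGeometricGraphDataCompat → InducesOfCompatible →
Cor39Compat`.  Nothing here takes a side on [IUTchIII] Cor. 3.12; typed ≠ discharged.
-/

namespace Literature.AnabelianGeometry.SemiGraphs

namespace ProfiniteSemiGraph

universe u

/-- **`Cor39Compat` from the steps of the proof of Cor. 3.9** (pp. 42–43): (a) = R1 ≫ R0;
(b)-existence = R2′ ≫ R3; (b)-uniqueness = R1 ×2 + `compatible_vertexMap_eq` + R4.
[cite: MochizukiSemiAnbd2006, Cor 3.9 pp.42-43] -/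
theorem cor39Compat_of_steps (h37i : VerticialInjective.{u}) (h37ii : VerticialDistinct.{u})
    (hR1 : InducesCompatible.{u}) (hR0 : InducedIsQuasiGeometric.{u})
    (hR2 : QuasiGeometricGraphDataCompat.{u}) (hR3 : InducesOfCompatible.{u})
    (hR4 : CompatibleEdgeMapUnique.{u}) : Cor39Compat.{u} := by
  intro 𝒢 ℋ h𝒢 hℋ c𝒢 cℋ
  refine ⟨fun F hF φ hind => ?_, fun φ hφ => ?_⟩
  · obtain ⟨hV, hE⟩ := hR1 𝒢 ℋ h𝒢 hℋ c𝒢 cℋ F φ hind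
    exact hR0 𝒢 ℋ h𝒢 hℋ c𝒢 cℋ F φ hF hV hE
  · obtain ⟨F, hF, hV, hE⟩ := hR2 𝒢 ℋ h𝒢 hℋ c𝒢 cℋ φ hφ
    refine ⟨F, hF, hR3 𝒢 ℋ h𝒢 hℋ c𝒢 cℋ F φ hF hV hE, fun F' hF' hind' => ?_⟩
    obtain ⟨hV', hE'⟩ := hR1 𝒢 ℋ h𝒢 hℋ c𝒢 cℋ F' φ hind'
    have hv : F'.base.vertexMap = F.base.vertexMap :=
      compatible_vertexMap_eq h37i h37ii h𝒢 hℋ c𝒢 cℋ hF' hV' hV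
    exact ⟨hv, hR4 𝒢 ℋ h𝒢 hℋ c𝒢 cℋ F' F φ hF' hF hV' hE' hV hE hv⟩

/-- **`Cor39Compat` from Thm. 3.7 (i), (iii), the twin step R2′ and R3** — binding
`verticialDistinct_holds`, `InducesCompatible_holds`, `InducedIsQuasiGeometric_of`,
`maximalCompactIffVerticial_of_thm37`, `edgeLikeDistinct_of`, `CompatibleEdgeMapUnique_of`.
[cite: MochizukiSemiAnbd2006, Cor 3.9 pp.42-43] -/
theorem cor39Compat_of_thm37_i_iii (h37i : VerticialInjective.{u}) (h37iii : CompactInVerticial.{u})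
    (hR2 : QuasiGeometricGraphDataCompat.{u}) (hR3 : InducesOfCompatible.{u}) : Cor39Compat.{u} :=
  cor39Compat_of_steps h37i verticialDistinct_holds InducesCompatible_holds
    (InducedIsQuasiGeometric_of h37i
      (maximalCompactIffVerticial_of_thm37 h37iii verticialDistinct_holds h37i))
    hR2 hR3
    (CompatibleEdgeMapUnique_of (edgeLikeDistinct_of h37iii verticialDistinct_holds h37i) h37i)

end ProfiniteSemiGraph

end Literature.AnabelianGeometry.SemiGraphs
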